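import Literature.Analysis.Complex.UnitDiscHyperbolicAut
import HarnessLib

/-!
# Homeomorphisms of the disc normalising `Aut(𝔻)`, I: the rotation-equivariant case

Topic `Literature/Analysis/Complex`.  Let `h` be a homeomorphism of the open unit disc `𝔻`
(given with its inverse `k` as total functions `ℂ → ℂ`) which **normalises** the group
`Aut(𝔻)` of holomorphic automorphisms: `h ∘ f ∘ h⁻¹ ∈ Aut(𝔻)` for every `f ∈ Aut(𝔻)`.  The
classical conclusion is that `h` is a holomorphic or an anti-holomorphic automorphism
(`Aut(𝔻) ≅ PSL₂(ℝ)` is normalised inside `Homeo(𝔻)` exactly by `PGL₂(ℝ)`; S. Mochizuki,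
*Topics in absolute anabelian geometry III*, Prop. 2.2, proves it via Cartan's theorem on
continuous automorphisms of Lie groups).  This file proves the core case by an elementary
hyperbolic-geometry argument replacing the Lie theory:

* `Literature.Analysis.Complex.eqOn_mul_of_normalizes_of_rot` — if moreover `h 0 = 0` and `h`
  commutes with the rotations about `0`, then `h` is a rotation on `𝔻`.

Route: `h` conjugates the half-turn `σ_q` to an involutive automorphism fixing `h q`, hence to
`σ_{h q}` (`h` is equivariant for the geodesic symmetries); by two-point homogeneity and the
isometric action of `Aut(𝔻)`, `cosh ρ(h z, h w)` is a function `Ψ` of `cosh ρ(z, w)`; comparing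
pairs on a circle about `0` (where `cosh ρ` is affine in the chordal parameter `‖u - v‖²` on
both sides, by rotation-equivariance) shows `Ψ` is affine, and the doubling identity
`cosh ρ(0, σ_q 0) = 2cosh² ρ(0, q) - 1` then forces `Ψ = id`: `h` is a hyperbolic isometry
fixing `0` and every ray, i.e. the identity up to the rotation `h(1/2)/(1/2)`.
Part II (`UnitDiscRCAutomorphisms.lean`) removes the two normalisations.

## Mathlib / tree

USED: `UnitDiscAutomorphisms` (Conway VI.2.5 via Schwarz), `UnitDiscHyperbolic`,
`UnitDiscHyperbolicAut` (Beardon §7).  Proof-only file (no definitions).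
-/

noncomputable section

open Set Filter Metric Function
open _root_.Complex
open scoped ComplexConjugate Topology

namespace Literature.Analysis.Complex

section Core

variable {h k : ℂ → ℂ}

/-! ### Conjugation bookkeeping -/

/-- `k 0 = 0` when `h 0 = 0` and `k` is a left inverse of `h` on the disc. [folklore] -/
private theorem k_zero (hkh : ∀ z ∈ ball (0 : ℂ) 1, k (h z) = z) (h0 : h 0 = 0) : k 0 = 0 := by
  simpa [h0] using hkh 0 (mem_ball_self one_pos)

/-- `(h ∘ f ∘ k) (h z) = h (f z)` on the disc. [folklore] -/
private theorem conj_apply (hkh : ∀ z ∈ ball (0 : ℂ) 1, k (h z) = z) (f : ℂ → ℂ) {z : ℂ}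
    (hz : z ∈ ball (0 : ℂ) 1) : (h ∘ f ∘ k) (h z) = h (f z) := by
  simp only [comp_apply, hkh z hz]

/-! ### Equivariance for half-turns -/

/-- **Equivariance for the geodesic symmetries**: a homeomorphism of the disc normalising
`Aut(𝔻)` satisfies `h ∘ σ_q = σ_{h q} ∘ h` on the disc, since `h σ_q h⁻¹` is an involutive
automorphism `≠ id` fixing `h q` (uniqueness of the half-turn).
[cite: MochizukiAbsTopIII2015, Proposition 2.2 (i) p.52] -/
theorem apply_discHalfTurn_of_normalizes (hm : MapsTo h (ball 0 1) (ball 0 1))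
    (km : MapsTo k (ball 0 1) (ball 0 1)) (hkh : ∀ z ∈ ball (0 : ℂ) 1, k (h z) = z)
    (hhk : ∀ z ∈ ball (0 : ℂ) 1, h (k z) = z) (hnorm : ∀ f, IsDiscAut f → IsDiscAut (h ∘ f ∘ k))
    {q : ℂ} (hq : ‖q‖ < 1) {w : ℂ} (hw : ‖w‖ < 1) :
    h (discHalfTurn q w) = discHalfTurn (h q) (h w) := by
  have hqm : q ∈ ball (0 : ℂ) 1 := mem_ball_zero_iff.2 hq
  have hwm : w ∈ ball (0 : ℂ) 1 := mem_ball_zero_iff.2 hw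
  set g := h ∘ discHalfTurn q ∘ k with hg
  have hgaut : IsDiscAut g := hnorm _ (isDiscAut_discHalfTurn hq)
  have hhq : ‖h q‖ < 1 := mem_ball_zero_iff.1 (hm hqm)
  have hgq : g (h q) = h q := by
    simp only [hg, comp_apply, hkh q hqm, discHalfTurn_self]
  have hginv : ∀ z ∈ ball (0 : ℂ) 1, g (g z) = z := by
    intro z hz
    have hkz : ‖k z‖ < 1 := mem_ball_zero_iff.1 (km hz)
    have hs : discHalfTurn q (k z) ∈ ball (0 : ℂ) 1 := mapsTo_discHalfTurn hq (km hz)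
    simp only [hg, comp_apply]
    rw [hkh _ hs, discHalfTurn_discHalfTurn hq hkz, hhk z hz]
  have hgne : ¬ EqOn g id (ball 0 1) := by
    intro hgid
    apply not_eqOn_discHalfTurn_id hq
    intro z hz
    have hz' : ‖z‖ < 1 := mem_ball_zero_iff.1 hz
    have h1 := hgid (hm hz)
    simp only [hg, comp_apply, hkh z hz, id] at h1
    -- `h (σ_q z) = h z`; apply `k`
    have h2 := congrArg k h1
    rwa [hkh _ (mapsTo_discHalfTurn hq hz), hkh z hz] at h2
  have key := hgaut.eqOn_discHalfTurn hhq hgq hginv hgne (hm hwm)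
  simpa [hg, hkh w hwm] using key

/-! ### `cosh ρ (h z, h w)` is a function of `cosh ρ (z, w)` -/

/-- For a homeomorphism `h` of the disc normalising `Aut(𝔻)`, `cosh ρ(h z, h w)` only depends on
`cosh ρ(z, w)` (two-point homogeneity and the isometric action of the conjugates
`h f h⁻¹ ∈ Aut(𝔻)`). [cite: MochizukiAbsTopIII2015, Proposition 2.2 (i) p.52] -/
theorem discCosh_apply_eq_of_discCosh_eq (hm : MapsTo h (ball 0 1) (ball 0 1))
    (hkh : ∀ z ∈ ball (0 : ℂ) 1, k (h z) = z) (hnorm : ∀ f, IsDiscAut f → IsDiscAut (h ∘ f ∘ k))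
    {z w z' w' : ℂ} (hz : ‖z‖ < 1) (hw : ‖w‖ < 1) (hz' : ‖z'‖ < 1) (hw' : ‖w'‖ < 1)
    (he : discCosh z w = discCosh z' w') :
    discCosh (h z) (h w) = discCosh (h z') (h w') := by
  obtain ⟨f, hf, hfz, hfw⟩ := exists_isDiscAut_apply_eq_apply_eq hz hw hz' hw' he
  have hg := hnorm f hf
  have hzm : z ∈ ball (0 : ℂ) 1 := mem_ball_zero_iff.2 hz
  have hwm : w ∈ ball (0 : ℂ) 1 := mem_ball_zero_iff.2 hw
  have e := hg.discCosh_eq (mem_ball_zero_iff.1 (hm hzm)) (mem_ball_zero_iff.1 (hm hwm))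
  simp only [comp_apply, hkh z hzm, hkh w hwm, hfz, hfw] at e
  exact e.symm

/-! ### The rotation-equivariant case -/

/-- A point `v` on the unit circle at prescribed chordal distance `‖1 - v‖² = S ∈ [0,4]` from `1`.
[folklore] -/
private theorem exists_unit_norm_one_sub_sq {S : ℝ} (hS0 : 0 ≤ S) (hS4 : S ≤ 4) :
    ∃ v : ℂ, ‖v‖ = 1 ∧ ‖1 - v‖ ^ 2 = S := by
  have hrad : 0 ≤ S - S ^ 2 / 4 := by nlinarith
  refine ⟨⟨1 - S / 2, Real.sqrt (S - S ^ 2 / 4)⟩, ?_, ?_⟩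
  · rw [Complex.norm_eq_sqrt_sq_add_sq, Real.sqrt_eq_one]
    simp only
    rw [Real.sq_sqrt hrad]
    ring
  · rw [← Complex.normSq_eq_norm_sq, Complex.normSq_apply]
    simp only [sub_re, one_re, sub_im, one_im, zero_sub, mul_neg, neg_mul, neg_neg]
    rw [← sq, ← sq, Real.sq_sqrt hrad]
    ring

/-- The **affine comparison on a circle**.  If `h 0 = 0`, `h` commutes with rotations and
normalises `Aut(𝔻)`, then for `0 < x < 1` and every pair `z, w ∈ 𝔻` whose `cosh ρ - 1` does not
exceed the maximum `8x²/(1-x²)²` attained on the circle of radius `x`,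
`cosh ρ(h z, h w) - 1 = m_x · (cosh ρ(z, w) - 1)` with
`m_x = (‖h x‖²/(1-‖h x‖²)²) / (x²/(1-x²)²)`. [cite: MochizukiAbsTopIII2015, Proposition 2.2 (i) p.52] -/
theorem discCosh_apply_sub_one_eq_mul (hm : MapsTo h (ball 0 1) (ball 0 1))
    (hkh : ∀ z ∈ ball (0 : ℂ) 1, k (h z) = z) (hnorm : ∀ f, IsDiscAut f → IsDiscAut (h ∘ f ∘ k))
    (hrot : ∀ u : ℂ, ‖u‖ = 1 → ∀ w ∈ ball (0 : ℂ) 1, h (u * w) = u * h w)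
    {x : ℝ} (hx0 : 0 < x) (hx1 : x < 1) {z w : ℂ} (hz : ‖z‖ < 1) (hw : ‖w‖ < 1)
    (hle : (discCosh z w - 1) * (1 - x ^ 2) ^ 2 ≤ 8 * x ^ 2) :
    discCosh (h z) (h w) - 1 =
      (‖h x‖ ^ 2 / (1 - ‖h x‖ ^ 2) ^ 2) / (x ^ 2 / (1 - x ^ 2) ^ 2) * (discCosh z w - 1) := by
  have hxn : ‖(x : ℂ)‖ < 1 := by
    rw [Complex.norm_real, Real.norm_of_nonneg hx0.le]; exact hx1
  have hxm : (x : ℂ) ∈ ball (0 : ℂ) 1 := mem_ball_zero_iff.2 hxn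
  have h1x : 0 < 1 - x ^ 2 := by nlinarith
  set t := discCosh z w - 1 with ht
  have ht0 : 0 ≤ t := by rw [ht]; linarith [one_le_discCosh hz hw]
  -- the chordal parameter realising `t` on the circle of radius `x`
  set S := t * (1 - x ^ 2) ^ 2 / (2 * x ^ 2) with hS
  have hS0 : 0 ≤ S := by positivity
  have hS4 : S ≤ 4 := by
    rw [hS, div_le_iff₀ (by positivity)]
    linarith
  obtain ⟨v, hv, hv1⟩ := exists_unit_norm_one_sub_sq hS0 hS4
  have hxv : ‖(x : ℂ) * v‖ < 1 := by rw [mul_comm, norm_mul, hv, one_mul]; exact hxn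
  -- the source pair `(x, x v)` has the same `cosh ρ` as `(z, w)`
  have hsrc : discCosh z w = discCosh ((1 : ℂ) * x) (v * x) := by
    rw [discCosh_mul_mul norm_one hv, Complex.norm_real, Real.norm_of_nonneg hx0.le, hv1, hS]
    field_simp
    ring
  have key := discCosh_apply_eq_of_discCosh_eq hm hkh hnorm hz hw (by simpa using hxn)
    (by rw [mul_comm]; exact hxv) hsrc
  -- the target pair is `(p, v p)` with `p = h x`
  rw [hrot v hv _ hxm, one_mul] at key
  have hp : ‖h x‖ < 1 := mem_ball_zero_iff.1 (hm hxm)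
  have h1p : 0 < 1 - ‖h (x : ℂ)‖ ^ 2 := by nlinarith [norm_nonneg (h (x : ℂ))]
  rw [key, show discCosh (h x) (v * h x) = discCosh (1 * h x) (v * h x) by rw [one_mul],
    discCosh_mul_mul norm_one hv, hv1, hS]
  field_simp
  ring

/-- **The rotation-equivariant normaliser is a hyperbolic isometry**: under the hypotheses of
`discCosh_apply_sub_one_eq_mul`, `cosh ρ(h z, h w) = cosh ρ(z, w)` for all `z, w ∈ 𝔻`.  (The
comparison factor `m_x` is independent of `x`, hence a global affine law
`cosh ρ(h z,h w) - 1 = m (cosh ρ(z,w) - 1)`; the doubling identity for the half-turn about `1/2`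
gives `m = m²`, and injectivity of `h` excludes `m = 0`.)
[cite: MochizukiAbsTopIII2015, Proposition 2.2 (i) p.52] -/
theorem discCosh_apply_eq_of_normalizes_of_rot (hm : MapsTo h (ball 0 1) (ball 0 1))
    (km : MapsTo k (ball 0 1) (ball 0 1)) (hkh : ∀ z ∈ ball (0 : ℂ) 1, k (h z) = z)
    (hhk : ∀ z ∈ ball (0 : ℂ) 1, h (k z) = z) (hnorm : ∀ f, IsDiscAut f → IsDiscAut (h ∘ f ∘ k))
    (h0 : h 0 = 0) (hrot : ∀ u : ℂ, ‖u‖ = 1 → ∀ w ∈ ball (0 : ℂ) 1, h (u * w) = u * h w)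
    {z w : ℂ} (hz : ‖z‖ < 1) (hw : ‖w‖ < 1) :
    discCosh (h z) (h w) = discCosh z w := by
  -- the comparison factor at radius `x`
  let M : ℝ → ℝ := fun x => (‖h x‖ ^ 2 / (1 - ‖h x‖ ^ 2) ^ 2) / (x ^ 2 / (1 - x ^ 2) ^ 2)
  have hloc : ∀ {x : ℝ}, 0 < x → x < 1 → ∀ {z w : ℂ}, ‖z‖ < 1 → ‖w‖ < 1 →
      (discCosh z w - 1) * (1 - x ^ 2) ^ 2 ≤ 8 * x ^ 2 →
      discCosh (h z) (h w) - 1 = M x * (discCosh z w - 1) :=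
    fun hx0 hx1 _ _ hz hw hle => discCosh_apply_sub_one_eq_mul hm hkh hnorm hrot hx0 hx1 hz hw hle
  -- a fixed small pair `(0, 1/4)` calibrates every `M x`, `x ≥ 1/2`
  have hq : ‖(1 / 4 : ℂ)‖ < 1 := by norm_num
  have hc0 : discCosh 0 (1 / 4 : ℂ) - 1 = 2 / 15 := by
    rw [discCosh_zero_left hq]; norm_num
  have hcal : ∀ {x : ℝ}, 1 / 2 ≤ x → x < 1 → M x = M (1 / 2) := by
    intro x hx hx1
    have hx0 : 0 < x := by linarith
    have hle1 : (discCosh 0 (1 / 4 : ℂ) - 1) * (1 - x ^ 2) ^ 2 ≤ 8 * x ^ 2 := by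
      rw [hc0]
      have ha : 0 ≤ 1 - x ^ 2 := by nlinarith
      have hb : 1 - x ^ 2 ≤ 1 := by nlinarith
      have hsq : (1 - x ^ 2) ^ 2 ≤ 1 := by nlinarith
      nlinarith
    have e1 := hloc hx0 hx1 (norm_zero.trans_lt one_pos) hq hle1
    have e2 := hloc (x := 1 / 2) (by norm_num) (by norm_num) (norm_zero.trans_lt one_pos) hq
      (by rw [hc0]; norm_num)
    rw [e1, hc0] at e2
    linarith
  set m := M (1 / 2) with hm_def
  -- global affine law
  have hglob : ∀ {z w : ℂ}, ‖z‖ < 1 → ‖w‖ < 1 → discCosh (h z) (h w) - 1 = m * (discCosh z w - 1) := by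
    intro z w hz hw
    set t := discCosh z w - 1 with ht
    have ht0 : 0 ≤ t := by rw [ht]; linarith [one_le_discCosh hz hw]
    -- radius `x` with `x² = 1 - y`, `y = min (3/4) (1/(t+1))`
    set y : ℝ := min (3 / 4) (1 / (t + 1)) with hy
    have hy0 : 0 < y := lt_min (by norm_num) (by positivity)
    have hy34 : y ≤ 3 / 4 := min_le_left _ _
    have hyt : y ≤ 1 / (t + 1) := min_le_right _ _
    set x : ℝ := Real.sqrt (1 - y) with hx
    have hx2 : x ^ 2 = 1 - y := Real.sq_sqrt (by linarith)
    have hx0 : 0 < x := Real.sqrt_pos.2 (by linarith)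
    have hx1 : x < 1 := by nlinarith
    have hxhalf : 1 / 2 ≤ x := by nlinarith
    have hle : t * (1 - x ^ 2) ^ 2 ≤ 8 * x ^ 2 := by
      rw [hx2, sub_sub_cancel]
      have hty : t * y ≤ 1 := by
        calc t * y ≤ t * (1 / (t + 1)) := by gcongr
          _ ≤ 1 := by rw [mul_one_div, div_le_one (by positivity)]; linarith
      nlinarith
    rw [hloc hx0 hx1 hz hw hle, hcal hxhalf hx1]
  -- doubling at `q = 1/2` forces `m = m²`
  have hq2 : ‖(1 / 2 : ℂ)‖ < 1 := by norm_num
  have hq2m : (1 / 2 : ℂ) ∈ ball (0 : ℂ) 1 := mem_ball_zero_iff.2 hq2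
  have hσ : ‖discHalfTurn (1 / 2 : ℂ) 0‖ < 1 := norm_discHalfTurn_lt_one hq2 (by simp)
  have hc2 : discCosh 0 (1 / 2 : ℂ) = 5 / 3 := by rw [discCosh_zero_left hq2]; norm_num
  have hhq : ‖h (1 / 2 : ℂ)‖ < 1 := mem_ball_zero_iff.1 (hm hq2m)
  have e1 := hglob (norm_zero.trans_lt one_pos) hσ
  rw [h0, apply_discHalfTurn_of_normalizes hm km hkh hhk hnorm hq2 (by simp), h0,
    discCosh_zero_discHalfTurn_zero hhq, discCosh_zero_discHalfTurn_zero hq2, hc2] at e1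
  have e2 := hglob (norm_zero.trans_lt one_pos) hq2
  rw [h0, hc2] at e2
  -- `e2 : cosh(0,h(1/2)) - 1 = m·(2/3)`, `e1 : 2 cosh(0,h(1/2))² - 1 - 1 = m·(2·(5/3)² - 1 - 1)`
  have hmm : m * (m - 1) = 0 := by nlinarith
  have hm0 : m ≠ 0 := by
    intro hm0
    rw [hm0, zero_mul, sub_eq_zero, discCosh_eq_one_iff (norm_zero.trans_lt one_pos) hhq] at e2
    -- `h (1/2) = 0 = h 0` contradicts injectivity
    have := congrArg k e2
    rw [k_zero hkh h0, hkh _ hq2m] at this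
    norm_num at this
  have hm1 : m = 1 := by
    have := mul_eq_zero.1 hmm
    rcases this with h' | h'
    · exact absurd h' hm0
    · linarith
  have := hglob hz hw
  rw [hm1, one_mul] at this
  linarith

/-- **Homeomorphisms normalising `Aut(𝔻)`, rotation-equivariant case.**  Let `h` be a
homeomorphism of the unit disc (inverse `k`) with `h 0 = 0`, commuting with the rotations about
`0`, and such that `h ∘ f ∘ h⁻¹ ∈ Aut(𝔻)` for every holomorphic automorphism `f` of the disc.  Then
`h` is a rotation: `h z = c z` on `𝔻` for a constant `‖c‖ = 1`.  (Elementary replacement for the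
Lie-theoretic step in the proof of [AbsTopIII] Prop. 2.2.)
[cite: MochizukiAbsTopIII2015, Proposition 2.2 (i) p.52] -/
theorem eqOn_mul_of_normalizes_of_rot (hm : MapsTo h (ball 0 1) (ball 0 1))
    (km : MapsTo k (ball 0 1) (ball 0 1)) (hkh : ∀ z ∈ ball (0 : ℂ) 1, k (h z) = z)
    (hhk : ∀ z ∈ ball (0 : ℂ) 1, h (k z) = z) (hnorm : ∀ f, IsDiscAut f → IsDiscAut (h ∘ f ∘ k))
    (h0 : h 0 = 0) (hrot : ∀ u : ℂ, ‖u‖ = 1 → ∀ w ∈ ball (0 : ℂ) 1, h (u * w) = u * h w) :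
    ∃ c : ℂ, ‖c‖ = 1 ∧ EqOn h (fun z => c * z) (ball 0 1) := by
  have hiso : ∀ {z w : ℂ}, ‖z‖ < 1 → ‖w‖ < 1 → discCosh (h z) (h w) = discCosh z w :=
    fun hz hw => discCosh_apply_eq_of_normalizes_of_rot hm km hkh hhk hnorm h0 hrot hz hw
  -- `h` preserves `‖·‖`
  have hnormeq : ∀ {z : ℂ}, ‖z‖ < 1 → ‖h z‖ = ‖z‖ := by
    intro z hz
    have e := hiso (norm_zero.trans_lt one_pos) hz
    rw [h0] at e
    exact norm_eq_norm_of_discCosh_zero_eq (mem_ball_zero_iff.1 (hm (mem_ball_zero_iff.2 hz))) hz e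
  -- on the real radius `(0,1)`, `h x = c x` with `c = 2 h(1/2)`
  set c : ℂ := 2 * h (1 / 2 : ℂ) with hc
  have hhalf : ‖h (1 / 2 : ℂ)‖ = 1 / 2 := by
    rw [hnormeq (by norm_num)]; norm_num
  have hcn : ‖c‖ = 1 := by
    rw [hc, norm_mul, hhalf]; norm_num
  have hreal : ∀ {x : ℝ}, 0 < x → x < 1 → h x = c * x := by
    intro x hx0 hx1
    have hxn : ‖(x : ℂ)‖ < 1 := by rw [Complex.norm_real, Real.norm_of_nonneg hx0.le]; exact hx1
    have hhx : ‖h x‖ = x := by rw [hnormeq hxn, Complex.norm_real, Real.norm_of_nonneg hx0.le]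
    -- compare the pair `(x, 1/2)`
    have e := hiso hxn (show ‖(1 / 2 : ℂ)‖ < 1 by norm_num)
    rw [discCosh, discCosh, hhx, hhalf, Complex.norm_real, Real.norm_of_nonneg hx0.le,
      show ‖(1 / 2 : ℂ)‖ = 1 / 2 by norm_num] at e
    have h1 : (1 - x ^ 2) * (1 - (1 / 2 : ℝ) ^ 2) ≠ 0 := by
      have : 0 < 1 - x ^ 2 := by nlinarith
      positivity
    rw [add_right_inj, div_left_inj' h1, mul_right_inj' two_ne_zero] at e
    -- `e : ‖h x - h (1/2)‖² = ‖x - 1/2‖²`; expand through `normSq`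
    set p := h (x : ℂ) with hp
    set r := h (1 / 2 : ℂ) with hr
    have hp2 : p.re * p.re + p.im * p.im = x ^ 2 := by
      rw [← Complex.normSq_apply, ← Complex.sq_norm, hhx]
    have hr2 : r.re * r.re + r.im * r.im = (1 / 2) ^ 2 := by
      rw [← Complex.normSq_apply, ← Complex.sq_norm, hhalf]
    have e3 : (p.re - r.re) * (p.re - r.re) + (p.im - r.im) * (p.im - r.im) = (x - 1 / 2) ^ 2 := by
      have lhs : ‖p - r‖ ^ 2 = (p.re - r.re) * (p.re - r.re) + (p.im - r.im) * (p.im - r.im) := by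
        rw [Complex.sq_norm, Complex.normSq_apply, sub_re, sub_im]
      have rhs : ‖(x : ℂ) - 1 / 2‖ ^ 2 = (x - 1 / 2) ^ 2 := by
        rw [show ((x : ℂ) - 1 / 2) = ((x - 1 / 2 : ℝ) : ℂ) by push_cast; ring, Complex.sq_norm,
          Complex.normSq_ofReal, sq]
      rw [← lhs, ← rhs]
      exact e
    -- hence `p = 2x · r` (equality case of Cauchy–Schwarz)
    have e4 : p.re * r.re + p.im * r.im = x * (1 / 2) := by
      linear_combination (-1 / 2 : ℝ) * e3 + (1 / 2 : ℝ) * hp2 + (1 / 2 : ℝ) * hr2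
    have e5 : (p.re - 2 * x * r.re) ^ 2 + (p.im - 2 * x * r.im) ^ 2 = 0 := by
      linear_combination hp2 - 4 * x * e4 + 4 * x ^ 2 * hr2
    have e6a : p.re - 2 * x * r.re = 0 := by
      have h7 : (p.re - 2 * x * r.re) ^ 2 = 0 :=
        le_antisymm (by linarith [sq_nonneg (p.im - 2 * x * r.im)]) (sq_nonneg _)
      exact (pow_eq_zero_iff two_ne_zero).1 h7
    have e6b : p.im - 2 * x * r.im = 0 := by
      have h7 : (p.im - 2 * x * r.im) ^ 2 = 0 :=
        le_antisymm (by linarith [sq_nonneg (p.re - 2 * x * r.re)]) (sq_nonneg _)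
      exact (pow_eq_zero_iff two_ne_zero).1 h7
    have hpr : p = ((2 * x : ℝ) : ℂ) * r := by
      apply Complex.ext
      · rw [Complex.re_ofReal_mul]; linarith
      · rw [Complex.im_ofReal_mul]; linarith
    rw [hpr, hc]
    push_cast
    ring
  refine ⟨c, hcn, fun z hz => ?_⟩
  have hz' : ‖z‖ < 1 := mem_ball_zero_iff.1 hz
  by_cases hz0 : z = 0
  · simp [hz0, h0]
  -- polar decomposition `z = u · ‖z‖`
  have hzn : 0 < ‖z‖ := norm_pos_iff.2 hz0
  set u : ℂ := z / (‖z‖ : ℂ) with hu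
  have hun : ‖u‖ = 1 := by
    rw [hu, norm_div, Complex.norm_real, Real.norm_of_nonneg hzn.le, div_self hzn.ne']
  have hzu : z = u * (‖z‖ : ℂ) := by
    rw [hu, div_mul_cancel₀]
    exact_mod_cast hzn.ne'
  have hmem : ((‖z‖ : ℝ) : ℂ) ∈ ball (0 : ℂ) 1 := by
    rw [mem_ball_zero_iff, Complex.norm_real, Real.norm_of_nonneg hzn.le]; exact hz'
  calc h z = h (u * (‖z‖ : ℂ)) := by rw [← hzu]
    _ = u * h (‖z‖ : ℂ) := hrot u hun _ hmem
    _ = u * (c * (‖z‖ : ℂ)) := by rw [hreal hzn hz']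
    _ = c * z := by rw [← mul_assoc, mul_comm u c, mul_assoc, ← hzu]

end Core

/-! ### A corollary: norm preservation -/

section NormCorollary

variable {h k : ℂ → ℂ}

/-- Under the hypotheses of `discCosh_apply_eq_of_normalizes_of_rot` (a homeomorphism of the disc
normalising `Aut(𝔻)`, fixing `0` and commuting with rotations), `h` preserves `‖·‖`: it is a
`cosh ρ`-isometry fixing the origin. [cite: Beardon1983, Thm. 7.4.1] -/
theorem norm_apply_eq_of_normalizes_of_rot (hm : MapsTo h (ball 0 1) (ball 0 1))
    (km : MapsTo k (ball 0 1) (ball 0 1)) (hkh : ∀ z ∈ ball (0 : ℂ) 1, k (h z) = z)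
    (hhk : ∀ z ∈ ball (0 : ℂ) 1, h (k z) = z) (hnorm : ∀ f, IsDiscAut f → IsDiscAut (h ∘ f ∘ k))
    (h0 : h 0 = 0) (hrot : ∀ u : ℂ, ‖u‖ = 1 → ∀ w ∈ ball (0 : ℂ) 1, h (u * w) = u * h w)
    {z : ℂ} (hz : ‖z‖ < 1) : ‖h z‖ = ‖z‖ := by
  have e := discCosh_apply_eq_of_normalizes_of_rot hm km hkh hhk hnorm h0 hrot
    (show ‖(0 : ℂ)‖ < 1 by simp) hz
  rw [h0] at e
  exact norm_eq_norm_of_discCosh_zero_eq (mem_ball_zero_iff.1 (hm (mem_ball_zero_iff.2 hz))) hz e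

end NormCorollary

end Literature.Analysis.Complex
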